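import Literature.AlgebraicGeometry.HodgeTheory.DiagonalSymmetry
import Literature.AlgebraicGeometry.Motives.Sweep1
import HarnessLib

/-!
# Permutations of the coordinates of a projective hypersurface and their action on complex points

Family `hodge`, layer `Literature/AlgebraicGeometry/HodgeTheory`. Companion of `DiagonalSymmetry` (the
diagonal symmetries `[z] ↦ [a • z]` of `X_F = V₊(F) ⊂ ℙⁿ⁺¹_ℂ`) for the OTHER visible symmetries of a
symmetric form: the permutations of the coordinates. For a form `F ∈ ℂ[x₀, …, x_{n+1}]` and a
permutation `π` of `Fin (n + 2)` with `F(x_{π 0}, …, x_{π (n+1)}) = F` (`π ∈ permStabilizer F`; every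
`π` for the Fermat form `Σ xᵢᵐ`, `permStabilizer_fermatPolynomial`) this file constructs the
**algebraic automorphism** `permAut F hπ : X_F ⟶ X_F` over `ℂ` (the restriction of the projective
linear transformation `permProjMap π : [z] ↦ [z ∘ π]` of `ℙⁿ⁺¹_ℂ`, `Motives.ProjectiveSpace.substMap`
of the substitution `xᵢ ↦ x_{π i}`, lifted through the universal property of the reduced induced
structure exactly as `diagonalAut`), the induced continuous self-map `permMap F hπ` of `X_F(ℂ)`, and
PROVES:

* `hypersurfacePoint_permMap`: `pt (p_π x) = [z ∘ π]` if `pt x = [z]` — the map acts as `z ↦ z ∘ π`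
  on homogeneous coordinates — and the uniqueness `eq_permMap_of_forall_exists_rep` (any self-map
  with this coordinate description is `p_π`);
* the group law on complex points `permMap_one`, `permMap_mul` (`p_{πρ} = p_ρ ∘ p_π`, a right
  action), `permMap_inv_comp`, `permMap_comp_inv`, and `permHomeomorph`.

The scheme-level group law (`permAutIso`: each `p_π` is an automorphism of the scheme `X_F`, by
Mathlib `Proj.map_comp` / `Proj.map_id`), the stability of `algebraicClasses` under `p_π^*` and the
relation `g_{b ∘ π} ∘ p_π = p_π ∘ g_b` with the diagonal symmetries are in the sequel
`FermatInductiveClaimsProofs`, where they serve the symmetric-group invariance of Aoki's claim(α)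
("`α ∼ β`: equality up to permutation of the components", Aoki 1987 §1; Shioda 1979 §1).

## Design

As in `DiagonalSymmetry`, no hypothesis on `F` beyond `rename π F = F` is needed. The substitution
`xᵢ ↦ x_{π i}` is `MvPolynomial.rename π` (`aeval_permSubst`, Mathlib `rename_eq_aeval`), so
`σ_π ∘ σ_ρ = σ_{πρ}` and `(σ_π G)(z) = G(z ∘ π)` are Mathlib's `rename_rename`, `eval_rename`.

## References

* R. Hartshorne, *Algebraic Geometry* (1977), II Example 7.1.1 (automorphisms of `ℙⁿ` from linear
  changes of coordinates), II Ex. 2.14, II Ex. 3.11 (d).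
* T. Shioda, *The Hodge conjecture for Fermat varieties*, Math. Ann. 245 (1979), §1 (the symmetries
  of `Xⁿₘ`); N. Aoki, *Some new algebraic cycles on Fermat varieties*, J. Math. Soc. Japan 39 (1987),
  §1 ("`α ∼ β`": equality up to permutation of the components).
* J.-P. Serre, *GAGA*, Ann. Inst. Fourier 6 (1956), §2 n°5.
-/

noncomputable section

open CategoryTheory AlgebraicGeometry MvPolynomial
open scoped LinearAlgebra.Projectivization

namespace Literature.AlgebraicGeometry.HodgeTheory

open Literature.AlgebraicGeometry.Motives Literature.NumberTheory.Transcendental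
  Literature.AlgebraicTopology.SingularHomology

attribute [local instance] MvPolynomial.gradedAlgebra Motives.ProjBaseChange.algebraBase

variable {n : ℕ}

/-- The grading of `ℂ[x₀, …, x_{n+1}]` by degree (local notation; `ℙ^{n+1}_ℂ = Proj 𝓐`). [folklore] -/
local notation "𝓐" => MvPolynomial.homogeneousSubmodule (Fin (n + 2)) ℂ

/-! ### The substitutions `xᵢ ↦ x_{π i}` -/

/-- The permutation substitution `xᵢ ↦ x_{π i}` attached to a permutation `π` of the coordinates, as
the family of linear forms `(x_{π i})ᵢ`. [cite: Hartshorne1977, II Example 7.1.1] -/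
def permSubst (π : Equiv.Perm (Fin (n + 2))) : Fin (n + 2) → MvPolynomial (Fin (n + 2)) ℂ :=
  fun i ↦ X (π i)

/-- `permSubst π i = x_{π i}` (`rfl`). [folklore] -/
@[simp]
theorem permSubst_apply (π : Equiv.Perm (Fin (n + 2))) (i : Fin (n + 2)) : permSubst π i = X (π i) := rfl

/-- The forms `x_{π i}` are linear. [folklore] -/
theorem isHomogeneous_permSubst (π : Equiv.Perm (Fin (n + 2))) (i : Fin (n + 2)) :
    (permSubst π i).IsHomogeneous 1 :=
  isHomogeneous_X ℂ (π i)

/-- Substituting `xᵢ ↦ x_{π i}` is Mathlib's `rename π`. [folklore] -/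
theorem aeval_permSubst (π : Equiv.Perm (Fin (n + 2))) (p : MvPolynomial (Fin (n + 2)) ℂ) :
    aeval (permSubst π) p = rename π p := by
  rw [rename_eq_aeval]
  rfl

/-- `σ_π ∘ σ_ρ = σ_{πρ}` on polynomials. [folklore] -/
theorem aeval_permSubst_aeval_permSubst (π ρ : Equiv.Perm (Fin (n + 2))) (p : MvPolynomial (Fin (n + 2)) ℂ) :
    aeval (permSubst π) (aeval (permSubst ρ) p) = aeval (permSubst (π * ρ)) p := by
  rw [aeval_permSubst, aeval_permSubst, aeval_permSubst, rename_rename, Equiv.Perm.coe_mul]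

/-- `σ_1 = id`. [folklore] -/
theorem aeval_permSubst_one (p : MvPolynomial (Fin (n + 2)) ℂ) :
    aeval (permSubst (1 : Equiv.Perm (Fin (n + 2)))) p = p := by
  rw [aeval_permSubst, Equiv.Perm.coe_one, rename_id_apply]

/-- `σ_π ∘ σ_{π⁻¹} = id`. [folklore] -/
theorem aeval_permSubst_aeval_permSubst_inv (π : Equiv.Perm (Fin (n + 2))) (p : MvPolynomial (Fin (n + 2)) ℂ) :
    aeval (permSubst π) (aeval (permSubst π⁻¹) p) = p := by
  rw [aeval_permSubst_aeval_permSubst, mul_inv_cancel, aeval_permSubst_one]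

/-- `(σ_π p)(z) = p(z ∘ π)`: substituting and then evaluating is evaluating at the permuted vector.
[folklore] -/
theorem eval_aeval_permSubst (π : Equiv.Perm (Fin (n + 2))) (z : Fin (n + 2) → ℂ)
    (p : MvPolynomial (Fin (n + 2)) ℂ) :
    MvPolynomial.eval z (aeval (permSubst π) p) = MvPolynomial.eval (z ∘ π) p := by
  rw [aeval_permSubst, eval_rename]

/-- A non-zero vector stays non-zero after permuting its coordinates. [folklore] -/
theorem comp_perm_ne_zero {v : Fin (n + 2) → ℂ} (hv : v ≠ 0) (π : Equiv.Perm (Fin (n + 2))) :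
    v ∘ π ≠ 0 := by
  intro h
  apply hv
  funext i
  have := congr_fun h (π.symm i)
  simpa using this

/-! ### The projective linear transformation `[z] ↦ [z ∘ π]` -/

/-- The projective linear transformation `[z] ↦ [z ∘ π]` of `ℙ^{n+1}_ℂ` over `ℂ` attached to a
permutation `π` of the coordinates (`Motives.ProjectiveSpace.substMap` of `σ_π`, inverse substitution
`σ_{π⁻¹}`). [cite: Hartshorne1977, II Example 7.1.1] -/
def permProjMap (π : Equiv.Perm (Fin (n + 2))) :
    Motives.projectiveSpace (n + 1) ℂ ⟶ Motives.projectiveSpace (n + 1) ℂ :=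
  ProjectiveSpace.substMap (permSubst π) (isHomogeneous_permSubst π) (permSubst π⁻¹)
    (isHomogeneous_permSubst π⁻¹) (aeval_permSubst_aeval_permSubst_inv π)

/-- `[z] ↦ [z ∘ π]` pulls `D₊(s)` back to `D₊(σ_π s)` (Mathlib `Proj.map_preimage_basicOpen`).
[folklore] -/
theorem permProjMap_preimage_basicOpen (π : Equiv.Perm (Fin (n + 2))) (s : MvPolynomial (Fin (n + 2)) ℂ) :
    (permProjMap π).left ⁻¹ᵁ Proj.basicOpen 𝓐 s = Proj.basicOpen 𝓐 (aeval (permSubst π) s) :=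
  ProjectiveSpace.substMap_preimage_basicOpen _ _ _ _ _ s

/-- `σ_π` preserves degrees. [folklore] -/
theorem aeval_permSubst_mem (π : Equiv.Perm (Fin (n + 2))) {m : ℕ} {s : MvPolynomial (Fin (n + 2)) ℂ}
    (hs : s ∈ 𝓐 m) : aeval (permSubst π) s ∈ 𝓐 m :=
  (ProjectiveSpace.substGraded (permSubst π) (isHomogeneous_permSubst π)).map_mem hs

/-- **On complex points `[z] ↦ [z ∘ π]` is what it says**: the `ℂ`-point of `ℙ^{n+1}_ℂ` with
homogeneous coordinates `v` is sent to the point with homogeneous coordinates `v ∘ π`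
(`[v] ∈ D₊(σ_π f) ↔ (σ_π f)(v) ≠ 0 ↔ f(v ∘ π) ≠ 0`). [cite: Hartshorne1977, II Ex. 2.14] -/
theorem map_permProjMap_projPoint (π : Equiv.Perm (Fin (n + 2))) (v : Fin (n + 2) → ℂ) (hv : v ≠ 0) :
    AlgPoints.map (permProjMap π) (projPoint (n + 1) (Projectivization.mk ℂ v hv)) =
      projPoint (n + 1) (Projectivization.mk ℂ (v ∘ π) (comp_perm_ne_zero hv π)) := by
  refine ComplexPoints.ext_of_pt_eq ?_
  rw [AlgPoints.pt_map, projPoint_mk, projPoint_mk]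
  refine Proj.ext_of_forall_mem_basicOpen_iff 𝓐 fun m hm f hf ↦ ?_
  change (pointOfVec (n + 1) v hv).pt ∈ (permProjMap π).left ⁻¹ᵁ Proj.basicOpen 𝓐 f ↔ _
  rw [permProjMap_preimage_basicOpen]
  refine (pt_pointOfVec_mem_basicOpen_iff (n + 1) v hv hm (aeval_permSubst_mem π hf)).trans ?_
  rw [eval_aeval_permSubst]
  exact (pt_pointOfVec_mem_basicOpen_iff (n + 1) _ _ hm hf).symm

/-! ### The permutation stabiliser of a form -/

/-- The **permutation stabiliser** of a form `F`: the subgroup of the permutations `π` of the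
coordinates with `F(x_{π 0}, …, x_{π (n+1)}) = F` as polynomials (all of `𝔖_{n+2}` for a symmetric
form such as the Fermat form, `permStabilizer_fermatPolynomial`). [cite: Shioda1979HodgeFermat, §1] -/
def permStabilizer (F : MvPolynomial (Fin (n + 2)) ℂ) : Subgroup (Equiv.Perm (Fin (n + 2))) where
  carrier := {π | aeval (permSubst π) F = F}
  mul_mem' {π ρ} hπ hρ := by
    change aeval (permSubst (π * ρ)) F = F
    rw [← aeval_permSubst_aeval_permSubst, hρ, hπ]
  one_mem' := aeval_permSubst_one F
  inv_mem' {π} hπ := by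
    change aeval (permSubst π⁻¹) F = F
    conv_lhs => rw [← hπ]
    rw [aeval_permSubst_aeval_permSubst, inv_mul_cancel, aeval_permSubst_one]

/-- Membership in the permutation stabiliser is exact invariance `σ_π F = F`. [folklore] -/
theorem mem_permStabilizer_iff {F : MvPolynomial (Fin (n + 2)) ℂ} {π : Equiv.Perm (Fin (n + 2))} :
    π ∈ permStabilizer F ↔ aeval (permSubst π) F = F := Iff.rfl

/-- `rename`-form of the membership. [folklore] -/
theorem mem_permStabilizer_iff_rename {F : MvPolynomial (Fin (n + 2)) ℂ} {π : Equiv.Perm (Fin (n + 2))} :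
    π ∈ permStabilizer F ↔ rename π F = F := by
  rw [mem_permStabilizer_iff, aeval_permSubst]

/-- **Every permutation of the coordinates fixes the Fermat form `Σ xᵢᵐ`.** [cite: Shioda1979HodgeFermat, §1] -/
theorem permStabilizer_fermatPolynomial (m : ℕ) : permStabilizer (fermatPolynomial ℂ n m) = ⊤ := by
  refine eq_top_iff.mpr fun π _ ↦ ?_
  rw [mem_permStabilizer_iff_rename, fermatPolynomial, map_sum]
  simp_rw [map_pow, rename_X]
  exact Equiv.sum_comp π (fun j ↦ (X j : MvPolynomial (Fin (n + 2)) ℂ) ^ m)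

/-- Every permutation lies in the stabiliser of the Fermat form. [cite: Shioda1979HodgeFermat, §1] -/
theorem mem_permStabilizer_fermatPolynomial (m : ℕ) (π : Equiv.Perm (Fin (n + 2))) :
    π ∈ permStabilizer (fermatPolynomial ℂ n m) := by
  rw [permStabilizer_fermatPolynomial]; exact Subgroup.mem_top π

/-- A permutation symmetry leaves the values of `F` invariant: `F(z ∘ π) = F(z)`. [folklore] -/
theorem eval_comp_perm_of_mem_permStabilizer {F : MvPolynomial (Fin (n + 2)) ℂ} {π : Equiv.Perm (Fin (n + 2))}
    (hπ : π ∈ permStabilizer F) (z : Fin (n + 2) → ℂ) :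
    MvPolynomial.eval (z ∘ π) F = MvPolynomial.eval z F := by
  rw [← eval_aeval_permSubst, mem_permStabilizer_iff.mp hπ]

/-! ### The algebraic automorphism `X_F ⟶ X_F` of a permutation symmetry -/

section Aut

variable (F : MvPolynomial (Fin (n + 2)) ℂ) {π ρ : Equiv.Perm (Fin (n + 2))}

/-- For `π` in the stabiliser, `[z] ↦ [z ∘ π]` maps `V₊(F)` into itself (it pulls `D₊(F)` back to
`D₊(σ_π F) = D₊(F)`). [cite: Shioda1979HodgeFermat, §1] -/
theorem range_ι_comp_permProjMap_subset (hπ : π ∈ permStabilizer F) :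
    Set.range ((SmoothHypersurface.hypersurfaceι F).left ≫ (permProjMap π).left) ⊆
      Set.range (SmoothHypersurface.hypersurfaceι F).left := by
  rintro _ ⟨x, rfl⟩
  have hx : (SmoothHypersurface.hypersurfaceι F).left x ∈ ProjectiveSpectrum.zeroLocus 𝓐 {F} :=
    (Set.ext_iff.mp (SmoothHypersurface.range_hypersurfaceι F) _).mp ⟨x, rfl⟩
  rw [mem_zeroLocus_iff_notMem_basicOpen] at hx
  refine (Set.ext_iff.mp (SmoothHypersurface.range_hypersurfaceι F) _).mpr
    ((mem_zeroLocus_iff_notMem_basicOpen F _).mpr fun h ↦ hx ?_)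
  have h' : (SmoothHypersurface.hypersurfaceι F).left x ∈ (permProjMap π).left ⁻¹ᵁ Proj.basicOpen 𝓐 F := h
  rwa [permProjMap_preimage_basicOpen, mem_permStabilizer_iff.mp hπ] at h'

/-- **The algebraic automorphism of `X_F` induced by a permutation symmetry `π`**: the restriction of
`[z] ↦ [z ∘ π]` to `V₊(F)`, lifted to the reduced closed subscheme `X_F` by the universal property of
the reduced induced structure (`Motives.liftOfRangeSubset`, Hartshorne II Ex. 3.11(d)); a morphism
over `ℂ`. Its inverse is the automorphism of `π⁻¹` (`permAutIso`). [cite: Shioda1979HodgeFermat, §1]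
[cite: Hartshorne1977, II Ex. 3.11 (d)] -/
def permAut (hπ : π ∈ permStabilizer F) :
    SmoothHypersurface.hypersurface F ⟶ SmoothHypersurface.hypersurface F :=
  Over.homMk (liftOfRangeSubset (SmoothHypersurface.hypersurfaceι F).left
    ((SmoothHypersurface.hypersurfaceι F).left ≫ (permProjMap π).left)
    (range_ι_comp_permProjMap_subset F hπ)) (by
      rw [← Over.w (SmoothHypersurface.hypersurfaceι F), liftOfRangeSubset_comp_assoc, Category.assoc,
        Over.w (permProjMap π)])

/-- `permAut F hπ` followed by the embedding is the embedding followed by `[z] ↦ [z ∘ π]`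
(underlying schemes). [folklore] -/
@[reassoc]
theorem permAut_left_comp_ι (hπ : π ∈ permStabilizer F) :
    (permAut F hπ).left ≫ (SmoothHypersurface.hypersurfaceι F).left =
      (SmoothHypersurface.hypersurfaceι F).left ≫ (permProjMap π).left :=
  liftOfRangeSubset_comp _ _ (range_ι_comp_permProjMap_subset F hπ)

/-- `permAut F hπ ≫ ι = ι ≫ ([z] ↦ [z ∘ π])` over `ℂ`. [folklore] -/
@[reassoc]
theorem permAut_comp_ι (hπ : π ∈ permStabilizer F) :
    permAut F hπ ≫ SmoothHypersurface.hypersurfaceι F =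
      SmoothHypersurface.hypersurfaceι F ≫ permProjMap π := by
  ext : 1
  rw [Over.comp_left, Over.comp_left]
  exact permAut_left_comp_ι F hπ

/-! ### The continuous self-map of `X_F(ℂ)` and its coordinate description -/

/-- **The continuous self-map `p_π` of the complex points `X_F(ℂ)`** induced by the permutation
symmetry `π` (the map on `ℂ`-points of `permAut F hπ`, `Motives.AlgPoints.mapContinuous`).
[cite: Shioda1979HodgeFermat, §1] -/
def permMap (hπ : π ∈ permStabilizer F) :
    C(ComplexPoints (SmoothHypersurface.hypersurface F), ComplexPoints (SmoothHypersurface.hypersurface F)) :=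
  AlgPoints.mapContinuous (permAut F hπ)

/-- `p_π x` is the image of the `ℂ`-point `x` under `permAut F hπ`. [folklore] -/
theorem permMap_apply (hπ : π ∈ permStabilizer F) (x : ComplexPoints (SmoothHypersurface.hypersurface F)) :
    permMap F hπ x = AlgPoints.map (permAut F hπ) x := rfl

/-- **`p_π` acts as `z ↦ z ∘ π` on homogeneous coordinates**: if `pt x = [z]` then
`pt (p_π x) = [z ∘ π]`, `pt = hypersurfacePoint (hypersurfaceι F)`. [cite: Shioda1979HodgeFermat, §1] -/
theorem hypersurfacePoint_permMap (hπ : π ∈ permStabilizer F)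
    (x : ComplexPoints (SmoothHypersurface.hypersurface F)) :
    hypersurfacePoint (SmoothHypersurface.hypersurfaceι F) (permMap F hπ x) =
      Projectivization.mk ℂ ((hypersurfacePoint (SmoothHypersurface.hypersurfaceι F) x).rep ∘ π)
        (comp_perm_ne_zero (Projectivization.rep_nonzero _) π) := by
  refine hypersurfacePoint_eq_of_projPoint_eq _ _ ?_
  rw [← map_permProjMap_projPoint π _ (Projectivization.rep_nonzero _), Projectivization.mk_rep,
    projPoint_hypersurfacePoint, permMap_apply]
  change _ = (AlgPoints.map (SmoothHypersurface.hypersurfaceι F) ∘ AlgPoints.map (permAut F hπ)) x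
  rw [← AlgPoints.map_comp, permAut_comp_ι, AlgPoints.map_comp, Function.comp_apply]

/-- The coordinate description on chosen representatives: `rep (pt (p_π x)) = t • (rep (pt x) ∘ π)`
for some (non-zero) scalar `t`. [cite: Shioda1979HodgeFermat, §1] -/
theorem exists_rep_hypersurfacePoint_permMap (hπ : π ∈ permStabilizer F)
    (x : ComplexPoints (SmoothHypersurface.hypersurface F)) :
    ∃ t : ℂ, (hypersurfacePoint (SmoothHypersurface.hypersurfaceι F) (permMap F hπ x)).rep =
      t • ((hypersurfacePoint (SmoothHypersurface.hypersurfaceι F) x).rep ∘ π) := by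
  rw [hypersurfacePoint_permMap]
  obtain ⟨u, hu⟩ := Projectivization.exists_smul_eq_mk_rep ℂ
    ((hypersurfacePoint (SmoothHypersurface.hypersurfaceι F) x).rep ∘ π)
    (comp_perm_ne_zero (Projectivization.rep_nonzero _) π)
  exact ⟨u, by rw [← hu, Units.smul_def]⟩

variable {F}

/-- **Uniqueness: the coordinate description determines the map.** Any self-map of `X_F(ℂ)` acting
as `z ↦ z ∘ π` on homogeneous coordinates is `p_π` (the homogeneous-coordinate map `pt` is injective,
`isEmbedding_hypersurfacePoint`). [cite: SerreGAGA1956, §2 n°5] -/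
theorem eq_permMap_of_forall_exists_rep (hπ : π ∈ permStabilizer F)
    {g : ComplexPoints (SmoothHypersurface.hypersurface F) → ComplexPoints (SmoothHypersurface.hypersurface F)}
    (hg : ∀ x, ∃ t : ℂ, (hypersurfacePoint (SmoothHypersurface.hypersurfaceι F) (g x)).rep =
      t • ((hypersurfacePoint (SmoothHypersurface.hypersurfaceι F) x).rep ∘ π)) :
    g = permMap F hπ := by
  funext x
  obtain ⟨t, ht⟩ := hg x
  apply (isEmbedding_hypersurfacePoint (SmoothHypersurface.hypersurfaceι F)).injective
  rw [hypersurfacePoint_permMap, ← Projectivization.mk_rep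
    (hypersurfacePoint (SmoothHypersurface.hypersurfaceι F) (g x)), Projectivization.mk_eq_mk_iff']
  exact ⟨t, ht.symm⟩

/-- Continuous-map form of the uniqueness statement. [cite: SerreGAGA1956, §2 n°5] -/
theorem continuousMap_eq_permMap (hπ : π ∈ permStabilizer F)
    {g : C(ComplexPoints (SmoothHypersurface.hypersurface F), ComplexPoints (SmoothHypersurface.hypersurface F))}
    (hg : ∀ x, ∃ t : ℂ, (hypersurfacePoint (SmoothHypersurface.hypersurfaceι F) (g x)).rep =
      t • ((hypersurfacePoint (SmoothHypersurface.hypersurfaceι F) x).rep ∘ π)) :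
    g = permMap F hπ :=
  ContinuousMap.coe_injective (eq_permMap_of_forall_exists_rep hπ hg)

/-! ### Group law on complex points -/

/-- `p_1 = id`. [folklore] -/
theorem permMap_one :
    permMap F (one_mem (permStabilizer F)) = ContinuousMap.id _ :=
  (continuousMap_eq_permMap (one_mem _) (g := ContinuousMap.id _) fun x ↦ ⟨1, by
    simp only [ContinuousMap.id_apply, Equiv.Perm.coe_one, Function.comp_id, one_smul]⟩).symm

/-- `p_{πρ} = p_ρ ∘ p_π` (`[z] ↦ [z ∘ π] ↦ [z ∘ π ∘ ρ]`: the action on points is a right action).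
[folklore] -/
theorem permMap_mul (hπ : π ∈ permStabilizer F) (hρ : ρ ∈ permStabilizer F) :
    permMap F (mul_mem hπ hρ) = (permMap F hρ).comp (permMap F hπ) := by
  refine (continuousMap_eq_permMap (mul_mem hπ hρ) fun x ↦ ?_).symm
  obtain ⟨t, ht⟩ := exists_rep_hypersurfacePoint_permMap F hρ (permMap F hπ x)
  obtain ⟨s, hs⟩ := exists_rep_hypersurfacePoint_permMap F hπ x
  refine ⟨t * s, ?_⟩
  rw [ContinuousMap.comp_apply, ht, hs]
  funext i
  simp only [Pi.smul_apply, Function.comp_apply, smul_eq_mul, Equiv.Perm.coe_mul, mul_assoc]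

/-- `p_{π⁻¹} ∘ p_π = id`. [folklore] -/
theorem permMap_inv_comp (hπ : π ∈ permStabilizer F) :
    (permMap F (inv_mem hπ)).comp (permMap F hπ) = ContinuousMap.id _ := by
  rw [← permMap_mul hπ (inv_mem hπ), ← permMap_one (F := F)]
  congr 1
  exact mul_inv_cancel π

/-- `p_π ∘ p_{π⁻¹} = id`. [folklore] -/
theorem permMap_comp_inv (hπ : π ∈ permStabilizer F) :
    (permMap F hπ).comp (permMap F (inv_mem hπ)) = ContinuousMap.id _ := by
  rw [← permMap_mul (inv_mem hπ) hπ, ← permMap_one (F := F)]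
  congr 1
  exact inv_mul_cancel π

/-- **`p_π` is a homeomorphism of `X_F(ℂ)`** with inverse `p_{π⁻¹}`. [cite: Shioda1979HodgeFermat, §1] -/
def permHomeomorph (hπ : π ∈ permStabilizer F) :
    ComplexPoints (SmoothHypersurface.hypersurface F) ≃ₜ ComplexPoints (SmoothHypersurface.hypersurface F) where
  toFun := permMap F hπ
  invFun := permMap F (inv_mem hπ)
  left_inv x := by
    change ((permMap F (inv_mem hπ)).comp (permMap F hπ)) x = x
    rw [permMap_inv_comp]; rfl
  right_inv x := by
    change ((permMap F hπ).comp (permMap F (inv_mem hπ))) x = x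
    rw [permMap_comp_inv]; rfl
  continuous_toFun := (permMap F hπ).continuous
  continuous_invFun := (permMap F (inv_mem hπ)).continuous

end Aut

end Literature.AlgebraicGeometry.HodgeTheory

end
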